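import Literature.Analysis.FluidPDE.ParticleTrajectoryMap
import Literature.Analysis.FluidPDE.MovingDomainTransportFormula
import Literature.Analysis.FluidPDE.IncompressibleFlow
import HarnessLib

/-!
# Majda–Bertozzi §1.3 for the constructed particle-trajectory map:
# (1.15), `J > 0`, Prop. 1.4 (ii) ⟺ (iii) and the transport formula (1.16), hypothesis-free

Literature file (topic `Analysis/FluidPDE`): A. J. Majda, A. L. Bertozzi, *Vorticity and
Incompressible Flow* (CUP 2002), §1.3, held text pp. 13–15 ((1.13)–(1.16), Props. 1.2–1.4).

The tree's `ParticleTrajectoryJacobian.lean` ((1.15), Prop. 1.4 (ii) ⟺ (iii)) and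
`MovingDomainTransportFormula.lean` (`J > 0`, the change of variables `α ↦ X(α,t)`, Prop. 1.3
(1.16)) are stated for a trajectory map `X` given as a HYPOTHESIS (jointly smooth, `∂ₜX = u(t,X)`
within the time set, `X(0,·) = id`, injective/surjective slices). For a velocity field
`u : ℝ → E → E` (time first; `E` a finite-dimensional real inner product space with its volume
measure — MB: `ℝᴺ`; v1/v2 of this file were written on `ℝ³`) that is jointly `C^∞` with a global
space–time Lipschitz bound,
`ParticleTrajectoryMap.lean` CONSTRUCTS that map, `X = particleTrajectoryMap hC` ((1.13):
`particleTrajectoryMap_zero`, `hasDerivAt_particleTrajectoryMap`, jointly smooth, every `X(·,t)`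
a bijection). This file discharges the hypotheses: every statement below is about
`particleTrajectoryMap hC` and assumes only `hC : LipschitzWith C (uncurry u)` and
`hu : ContDiff ℝ ∞ (uncurry u)` (plus the data of the particular statement). All statements are
theorems; no definitions, no named facts.

* `hasDerivAt_jacobian_particleTrajectoryMap` — **(1.15)** `∂ₜJ(α,t) = (div u)(X(α,t),t) J(α,t)`
  at every `t ∈ ℝ` (two-sided derivative).
* `det_fderiv_particleTrajectoryMap_pos` — `J > 0` on `ℝ × E`.
* `det_fderiv_particleTrajectoryMap_eq_one`, `isDivFree_of_det_fderiv_particleTrajectoryMap_eq_one`,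
  `isDivFree_iff_det_fderiv_particleTrajectoryMap_eq_one` — **Prop. 1.4 (ii) ⟺ (iii)** on a
  convex time set `S ∋ 0` (of unique differentiability for ⇐).
* `setIntegral_image_particleTrajectoryMap_eq` — `∫_{X(Ω,t)} g dx = ∫_Ω g(X(α,t)) J(α,t) dα`
  for every measurable `Ω` and every `t`.
* `hasDerivWithinAt_setIntegral_image_particleTrajectoryMap` — **Prop. 1.3 (1.16)** within a
  convex time set `S ∋ 0` of unique differentiability on which `f` is jointly smooth, for every
  bounded measurable `Ω`; `hasDerivAt_setIntegral_image_particleTrajectoryMap` — the two-sided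
  form for `f` jointly smooth on `ℝ × E`, with `f_t = ∂f/∂t`.
* `hasDerivWithinAt_setIntegral_image_particleTrajectoryMap_of_isDivFree` — (1.16) for
  `div u = 0`; `hasDerivAt_volume_image_particleTrajectoryMap` — (1.16) with `f ≡ 1`:
  `d/dt vol X(Ω,t) = ∫_{X(Ω,t)} div u dx` at every `t`.
* `isIncompressibleFlowOn_particleTrajectoryMap_iff_isDivFree` — **Prop. 1.4 (i) ⟺ (ii)** for
  the constructed flow (Def. 1.1 `IsIncompressibleFlowOn` of `IncompressibleFlow.lean`): the
  flow is volume preserving on `S` iff `div u = 0` on `S`; and `…_iff_det_fderiv_eq_one`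
  ((i) ⟺ (iii)).

HONEST FRAMING (cell `pub-fluidc`): typed textbook infrastructure for a low prior, high
value-of-information experiment on Tao's machine paradigm; NOT a claim that NS blows up.

## References

* [MajdaBertozziCUP2002] A. J. Majda, A. L. Bertozzi, Vorticity and Incompressible Flow, CUP 2002
  — §1.3 (1.13)–(1.16), Props. 1.2, 1.3, 1.4 (held text pp. 13–15).
-/

noncomputable section

open Set Function Filter Topology MeasureTheory Metric
open scoped NNReal ContDiff

namespace Literature.Analysis.FluidPDE

section FinDim

variable {E : Type*} [NormedAddCommGroup E] [InnerProductSpace ℝ E] [FiniteDimensional ℝ E]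
variable {C : ℝ≥0} {S : Set ℝ} {u : ℝ → E → E} {f : ℝ → E → ℝ}

/-- (1.13) within any time set, in the `∀ t ∈ S, ∀ y` form of the tree's Lagrangian files.
[cite: MajdaBertozziCUP2002, §1.3 (1.13)] -/
private theorem traj (hC : LipschitzWith C (uncurry u)) (S : Set ℝ) :
    ∀ t ∈ S, ∀ y, HasDerivWithinAt (fun s => particleTrajectoryMap hC s y)
      (u t (particleTrajectoryMap hC t y)) S t :=
  fun t _ y => hasDerivWithinAt_particleTrajectoryMap hC S t y

/-! ### (1.15) and `J > 0` -/

/-- **Majda–Bertozzi Prop. 1.2, eq. (1.15), for the constructed particle-trajectory map**: for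
`u` jointly smooth with a global space–time Lipschitz bound and `X = particleTrajectoryMap hC`,
`J(α,t) = det ∇_αX(α,t)` satisfies `∂ₜJ = (div u)(X(α,t),t) J` at every `t ∈ ℝ`.
[cite: MajdaBertozziCUP2002, §1.3 Prop. 1.2 eq. (1.15) (held text p. 14)] -/
theorem hasDerivAt_jacobian_particleTrajectoryMap (hC : LipschitzWith C (uncurry u))
    (hu : ContDiff ℝ ∞ (uncurry u)) (t : ℝ) (a : E) :
    HasDerivAt (fun r => (fderiv ℝ (particleTrajectoryMap hC r) a).det)
      (VectorCalculus.divergence (u t) (particleTrajectoryMap hC t a)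
        * (fderiv ℝ (particleTrajectoryMap hC t) a).det) t :=
  (hasDerivWithinAt_jacobian (S := univ) hu.contDiffOn
    (isSmoothSpaceTimeOn_particleTrajectoryMap hC hu univ) uniqueDiffOn_univ (traj hC univ)
    (mem_univ t) a).hasDerivAt univ_mem

/-- **`J > 0`** for the constructed particle-trajectory map: `det ∇_αX(α,t) > 0` for all
`t ∈ ℝ`, `α ∈ E`. [cite: MajdaBertozziCUP2002, §1.3 Prop. 1.2 eq. (1.15) (held text p. 14)] -/
theorem det_fderiv_particleTrajectoryMap_pos (hC : LipschitzWith C (uncurry u))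
    (hu : ContDiff ℝ ∞ (uncurry u)) (t : ℝ) (a : E) :
    0 < (fderiv ℝ (particleTrajectoryMap hC t) a).det :=
  det_fderiv_flow_pos (S := univ) convex_univ (mem_univ _) hu.contDiffOn
    (isSmoothSpaceTimeOn_particleTrajectoryMap hC hu univ) (traj hC univ)
    (particleTrajectoryMap_zero hC) (mem_univ t) a

/-! ### Prop. 1.4 (ii) ⟺ (iii) -/

/-- **Prop. 1.4 (ii) ⇒ (iii)** for the constructed map: if `div u(t,·) = 0` for `t` in a convex
time set `S ∋ 0`, then `J(α,t) = 1` on `S × E`.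
[cite: MajdaBertozziCUP2002, §1.3 Prop. 1.4 (ii) ⇒ (iii) (held text p. 14)] -/
theorem det_fderiv_particleTrajectoryMap_eq_one (hC : LipschitzWith C (uncurry u))
    (hu : ContDiff ℝ ∞ (uncurry u)) (hS : Convex ℝ S) (h0 : (0 : ℝ) ∈ S)
    (hdiv : ∀ t ∈ S, VectorCalculus.IsDivFree (u t)) {t : ℝ} (ht : t ∈ S)
    (a : E) : (fderiv ℝ (particleTrajectoryMap hC t) a).det = 1 :=
  det_fderiv_flow_eq_one hS h0 hu.contDiffOn (isSmoothSpaceTimeOn_particleTrajectoryMap hC hu S)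
    (traj hC S) (particleTrajectoryMap_zero hC) hdiv ht a

/-- **Prop. 1.4 (iii) ⇒ (ii)** for the constructed map (every `X(·,t)` is onto): if `J ≡ 1` on
`S × E` for a time set `S` of unique differentiability, then `div u(t,·) = 0` for `t ∈ S`.
[cite: MajdaBertozziCUP2002, §1.3 Prop. 1.4 (iii) ⇒ (ii) (held text p. 14)] -/
theorem isDivFree_of_det_fderiv_particleTrajectoryMap_eq_one (hC : LipschitzWith C (uncurry u))
    (hu : ContDiff ℝ ∞ (uncurry u)) (hU : UniqueDiffOn ℝ S)
    (hJ : ∀ t ∈ S, ∀ a, (fderiv ℝ (particleTrajectoryMap hC t) a).det = 1) {t : ℝ}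
    (ht : t ∈ S) : VectorCalculus.IsDivFree (u t) :=
  isDivFree_of_det_fderiv_flow_eq_one hu.contDiffOn
    (isSmoothSpaceTimeOn_particleTrajectoryMap hC hu S) hU (traj hC S)
    (fun t _ => (bijective_particleTrajectoryMap hC t).surjective) hJ ht

/-- **Prop. 1.4 (ii) ⟺ (iii)** for the constructed map, on a convex time set `S ∋ 0` of unique
differentiability: `div u = 0` on `S` iff `J ≡ 1` on `S × E`.
[cite: MajdaBertozziCUP2002, §1.3 Prop. 1.4 (held text p. 14)] -/
theorem isDivFree_iff_det_fderiv_particleTrajectoryMap_eq_one (hC : LipschitzWith C (uncurry u))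
    (hu : ContDiff ℝ ∞ (uncurry u)) (hS : Convex ℝ S) (h0 : (0 : ℝ) ∈ S)
    (hU : UniqueDiffOn ℝ S) :
    (∀ t ∈ S, VectorCalculus.IsDivFree (u t)) ↔
      ∀ t ∈ S, ∀ a, (fderiv ℝ (particleTrajectoryMap hC t) a).det = 1 :=
  isDivFree_iff_det_fderiv_flow_eq_one hS h0 hU hu.contDiffOn
    (isSmoothSpaceTimeOn_particleTrajectoryMap hC hu S) (traj hC S) (particleTrajectoryMap_zero hC)
    fun t _ => (bijective_particleTrajectoryMap hC t).surjective

/-! ### The change of variables and Prop. 1.3 (1.16) -/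

section Measure

variable [MeasurableSpace E] [BorelSpace E]

/-- **Change of variables along the constructed flow**: for every measurable `Ω` and every
`t ∈ ℝ`, `∫_{X(Ω,t)} g dx = ∫_Ω g(X(α,t)) J(α,t) dα`.
[cite: MajdaBertozziCUP2002, §1.3 proof of Prop. 1.3, first display (held text p. 14)] -/
theorem setIntegral_image_particleTrajectoryMap_eq (hC : LipschitzWith C (uncurry u))
    (hu : ContDiff ℝ ∞ (uncurry u)) (t : ℝ) {Ω : Set E}
    (hΩm : MeasurableSet Ω) (g : E → ℝ) :
    ∫ x in particleTrajectoryMap hC t '' Ω, g x =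
      ∫ a in Ω, g (particleTrajectoryMap hC t a) * (fderiv ℝ (particleTrajectoryMap hC t) a).det :=
  setIntegral_image_flow_eq (S := univ) convex_univ (mem_univ _) hu.contDiffOn
    (isSmoothSpaceTimeOn_particleTrajectoryMap hC hu univ) (traj hC univ)
    (particleTrajectoryMap_zero hC) (mem_univ t) hΩm
    (bijective_particleTrajectoryMap hC t).injective.injOn g

/-- **Majda–Bertozzi Prop. 1.3, the transport formula (1.16), for the constructed flow**: for
`u` jointly smooth with a global space–time Lipschitz bound, `X = particleTrajectoryMap hC`, a
convex time set `S ∋ 0` of unique differentiability, `f` jointly smooth on `S × E` and `Ω`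
bounded measurable, `d/dt ∫_{X(Ω,t)} f dx = ∫_{X(Ω,t)} [f_t + div(f u)] dx` within `S` at every
`t ∈ S` (`f_t = timeDerivWithin S f`).
[cite: MajdaBertozziCUP2002, §1.3 Prop. 1.3 eq. (1.16) (held text pp. 14–15)] -/
theorem hasDerivWithinAt_setIntegral_image_particleTrajectoryMap
    (hC : LipschitzWith C (uncurry u)) (hu : ContDiff ℝ ∞ (uncurry u)) (hS : Convex ℝ S)
    (h0 : (0 : ℝ) ∈ S) (hU : UniqueDiffOn ℝ S) (hf : IsSmoothSpaceTimeOn S f)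
    {Ω : Set E} (hΩm : MeasurableSet Ω) (hΩb : Bornology.IsBounded Ω)
    {t : ℝ} (ht : t ∈ S) :
    HasDerivWithinAt (fun s => ∫ x in particleTrajectoryMap hC s '' Ω, f s x)
      (∫ x in particleTrajectoryMap hC t '' Ω, (timeDerivWithin S f t x
        + VectorCalculus.divergence (fun y => f t y • u t y) x)) S t :=
  hasDerivWithinAt_setIntegral_image_flow hS h0 hU hu.contDiffOn
    (isSmoothSpaceTimeOn_particleTrajectoryMap hC hu S) (traj hC S) (particleTrajectoryMap_zero hC)
    hf hΩm hΩb (fun t _ => (bijective_particleTrajectoryMap hC t).injective.injOn) ht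

/-- **(1.16) for the constructed flow, two-sided in time**: for `f` jointly smooth on `ℝ × E`
and `Ω` bounded measurable, `d/dt ∫_{X(Ω,t)} f dx = ∫_{X(Ω,t)} [∂f/∂t + div(f u)] dx` at every
`t ∈ ℝ`. [cite: MajdaBertozziCUP2002, §1.3 Prop. 1.3 eq. (1.16) (held text pp. 14–15)] -/
theorem hasDerivAt_setIntegral_image_particleTrajectoryMap (hC : LipschitzWith C (uncurry u))
    (hu : ContDiff ℝ ∞ (uncurry u)) (hf : ContDiff ℝ ∞ (uncurry f))
    {Ω : Set E} (hΩm : MeasurableSet Ω) (hΩb : Bornology.IsBounded Ω)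
    (t : ℝ) :
    HasDerivAt (fun s => ∫ x in particleTrajectoryMap hC s '' Ω, f s x)
      (∫ x in particleTrajectoryMap hC t '' Ω, (deriv (fun s => f s x) t
        + VectorCalculus.divergence (fun y => f t y • u t y) x)) t := by
  have h := (hasDerivWithinAt_setIntegral_image_particleTrajectoryMap hC hu convex_univ
    (mem_univ _) uniqueDiffOn_univ hf.contDiffOn hΩm hΩb (mem_univ t)).hasDerivAt univ_mem
  simpa only [timeDerivWithin, derivWithin_univ] using h

/-- **(1.16) for the constructed flow of a divergence-free field**: if `div u(t,·) = 0`, then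
`d/dt ∫_{X(Ω,t)} f dx = ∫_{X(Ω,t)} (f_t + u · ∇f) dx` within `S` at `t`.
[cite: MajdaBertozziCUP2002, §1.3 Prop. 1.3 eq. (1.16) with Prop. 1.4 (ii) (held text p. 14)] -/
theorem hasDerivWithinAt_setIntegral_image_particleTrajectoryMap_of_isDivFree
    (hC : LipschitzWith C (uncurry u)) (hu : ContDiff ℝ ∞ (uncurry u)) (hS : Convex ℝ S)
    (h0 : (0 : ℝ) ∈ S) (hU : UniqueDiffOn ℝ S) (hf : IsSmoothSpaceTimeOn S f)
    {Ω : Set E} (hΩm : MeasurableSet Ω) (hΩb : Bornology.IsBounded Ω)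
    {t : ℝ} (ht : t ∈ S) (hdiv : VectorCalculus.IsDivFree (u t)) :
    HasDerivWithinAt (fun s => ∫ x in particleTrajectoryMap hC s '' Ω, f s x)
      (∫ x in particleTrajectoryMap hC t '' Ω,
        (timeDerivWithin S f t x + fderiv ℝ (f t) x (u t x))) S t :=
  hasDerivWithinAt_setIntegral_image_flow_of_isDivFree hS h0 hU hu.contDiffOn
    (isSmoothSpaceTimeOn_particleTrajectoryMap hC hu S) (traj hC S) (particleTrajectoryMap_zero hC)
    hf hΩm hΩb (fun t _ => (bijective_particleTrajectoryMap hC t).injective.injOn) ht hdiv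

/-- **(1.16) with `f ≡ 1` for the constructed flow: the rate of change of the volume of a
domain moving with the fluid** is `d/dt vol X(Ω,t) = ∫_{X(Ω,t)} div u dx` at every `t ∈ ℝ`
(two-sided), for every bounded measurable `Ω`.
[cite: MajdaBertozziCUP2002, §1.3 Prop. 1.3 eq. (1.16) with `f ≡ 1` (held text p. 14)] -/
theorem hasDerivAt_volume_image_particleTrajectoryMap (hC : LipschitzWith C (uncurry u))
    (hu : ContDiff ℝ ∞ (uncurry u)) {Ω : Set E}
    (hΩm : MeasurableSet Ω) (hΩb : Bornology.IsBounded Ω) (t : ℝ) :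
    HasDerivAt (fun s => (volume (particleTrajectoryMap hC s '' Ω)).toReal)
      (∫ x in particleTrajectoryMap hC t '' Ω, VectorCalculus.divergence (u t) x) t :=
  (hasDerivWithinAt_volume_image_flow (S := univ) convex_univ (mem_univ _) uniqueDiffOn_univ
    hu.contDiffOn (isSmoothSpaceTimeOn_particleTrajectoryMap hC hu univ) (traj hC univ)
    (particleTrajectoryMap_zero hC) hΩm hΩb
    (fun t _ => (bijective_particleTrajectoryMap hC t).injective.injOn) (mem_univ t)).hasDerivAt
    univ_mem

/-! ### Prop. 1.4 (i) ⟺ (ii) ⟺ (iii) for the constructed flow -/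

/-- **Prop. 1.4 (i) ⟺ (iii)** for the constructed flow: `X = particleTrajectoryMap hC` is volume
preserving on a convex time set `S ∋ 0` (Def. 1.1, `IsIncompressibleFlowOn`) iff `J ≡ 1` on
`S × E`. [cite: MajdaBertozziCUP2002, §1.3 Def. 1.1, Prop. 1.4 (i) ⟺ (iii) (held text p. 14)] -/
theorem isIncompressibleFlowOn_particleTrajectoryMap_iff_det_fderiv_eq_one
    (hC : LipschitzWith C (uncurry u)) (hu : ContDiff ℝ ∞ (uncurry u)) (hS : Convex ℝ S)
    (h0 : (0 : ℝ) ∈ S) :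
    IsIncompressibleFlowOn S (particleTrajectoryMap hC) ↔
      ∀ t ∈ S, ∀ a, (fderiv ℝ (particleTrajectoryMap hC t) a).det = 1 :=
  isIncompressibleFlowOn_iff_det_fderiv_eq_one hS h0 hu.contDiffOn
    (isSmoothSpaceTimeOn_particleTrajectoryMap hC hu S) (traj hC S) (particleTrajectoryMap_zero hC)
    fun t _ => (bijective_particleTrajectoryMap hC t).injective

/-- **Majda–Bertozzi Prop. 1.4 (i) ⟺ (ii) for the constructed flow**: for `u` jointly smooth
with a global space–time Lipschitz bound and a convex time set `S ∋ 0` of unique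
differentiability, the particle-trajectory flow `X = particleTrajectoryMap hC` is incompressible
on `S` (`vol X(Ω,t) = vol Ω` for all measurable `Ω`, `t ∈ S`) iff `div u(t,·) = 0` for all
`t ∈ S`. [cite: MajdaBertozziCUP2002, §1.3 Def. 1.1, Prop. 1.4 (i) ⟺ (ii) (held text p. 14)] -/
theorem isIncompressibleFlowOn_particleTrajectoryMap_iff_isDivFree
    (hC : LipschitzWith C (uncurry u)) (hu : ContDiff ℝ ∞ (uncurry u)) (hS : Convex ℝ S)
    (h0 : (0 : ℝ) ∈ S) (hU : UniqueDiffOn ℝ S) :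
    IsIncompressibleFlowOn S (particleTrajectoryMap hC) ↔
      ∀ t ∈ S, VectorCalculus.IsDivFree (u t) :=
  isIncompressibleFlowOn_iff_isDivFree hS h0 hU hu.contDiffOn
    (isSmoothSpaceTimeOn_particleTrajectoryMap hC hu S) (traj hC S) (particleTrajectoryMap_zero hC)
    fun t _ => bijective_particleTrajectoryMap hC t

end Measure

end FinDim

end Literature.Analysis.FluidPDE

end
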